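import Literature.NumberTheory.Automorphic.UnitaryRankTwoDepthValueLaw     -- ★ p843418 A-p13 (g31): `nil_mul_nil`, `one_add_smul_nil_mul_one_sub_smul_nil`, `one_sub_…`, `mem_glInt_iff` (via ReductiveGroupData)
import HarnessLib

/-!
# [LabesseLanglands1979 §2 pp. 8–9; Rogawski1990 §4.9] road «R1-ram» (tamely RAMIFIED place), R-3 rider for the VERTEX piece `K♯`: the SIGNED NORMAL-FORM ELEMENTS
# `u₁·(1 + ϖ^i N(η^e))` (even `i`) as elements of `U(J♯) ∩ GL₂(𝒪)`, `J♯ = [[0,−1],[1,0]]`, and their `D_ϖ`-conjugates in `U(J₀) ∩ K♯`, `K♯ = D_ϖ·GL₂(𝒪)·D_ϖ⁻¹`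

Topic `NumberTheory/Automorphic`; namespace `Literature.NumberTheory.Automorphic`.  THEOREMS ONLY (no definition, no instance, no notation, no named fact, no `sorry`).
Cell `pub/hodgecm-mathlib` (D-0151), crux H413 = `stmt-HodgeConjecture-24833`, residue `RankOneUnstableTransferNonsplitCMERamified` of #159; architect A-p16 (g27) RULING A-23 (b)
((R5b-α-VERTEX) → A-p03 (g26)); A-p03's census `CENSUS-R5b-alpha-VERTEX.A-p03g26.md` 41df4640 §4 ask + «WANT» 10:57:09Z; designer B-p12 (g29).  The EDGE twin is ★ A-p13 (g32)
`exists_unitary_signedNormalForm_elements` (p843738, odd `i`, `J₀`).  HONEST LABEL: HC_CM is proved only modulo the printed citations (the 2 remaining named inputs hLiu418,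
h413) until rung 0 closes; nothing printed is asserted here — elementary `2×2` algebra.

MATHEMATICS.  (1) `(c(1 + tN_δ))ᴴ·J♯·(c(1 + tN_δ)) = J♯ + c σc·(tδ − σ(tδ))·E₁₁`, so the window element `c(1 + ϖ^iN(η^e))` is `J♯`-unitary iff `ϖ^iη^e` is σ-FIXED iff `i` is EVEN
(`σϖ = −ϖ`, `ση = η`) — the vertex value points of ★ B-p12 `localClass_signedNormalForm_ramified_modular` (p843617); for odd `i` the family returns the scalar `c·1` (never read:
the vertex depths are even).  (2) With `D = D_ϖ = diag(1, ϖ)` one has `Dᴴ J₀ D = (−ϖ)·J♯`, hence `D·U(J♯)·D⁻¹ ⊆ U(J₀)`, and `D·N(δ)·D⁻¹ = N(δϖ⁻¹)`: the conjugated elements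
`c·(1 + ϖ^i·(D N(η^e) D⁻¹)) ∈ U(J₀) ∩ K♯` are the value points of the vertex piece inside the ONE group `U(J₀)` (A-p03's V2 head; `i = 0` included — keep the conjugated spelling).
Heads: **`exists_unitary_signedNormalForm_elements_modular`** (in `U(J♯) ∩ GL₂(𝒪)`), **`exists_conj_signedNormalForm_elements_modular`** (in `U(J₀) ∩ (GL₂(𝒪)).map (conj D)`).

## References
* [LabesseLanglands1979] J.-P. Labesse, R. P. Langlands, *L-indistinguishability for SL(2)*, Canad. J. Math. 31 (1979): §2, Lemma 2.1, pp. 8–9.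
* [Rogawski1990] J. D. Rogawski, *Automorphic Representations of Unitary Groups in Three Variables*, Ann. of Math. Stud. 123 (1990): §4.9 Lemma 4.9.3 p. 56.
* [Jacobowitz1962] R. Jacobowitz, *Hermitian forms over local fields*, Amer. J. Math. 84 (1962): §4, §8.
-/

set_option autoImplicit false

noncomputable section

open scoped ValuativeRel Matrix MatrixGroups
open Matrix ValuativeRel

namespace Literature.NumberTheory.Automorphic

variable {F : Type*} [Field F] [ValuativeRel F]

/-! ## §1 Algebra: `J♯`-unitarity of the window elements, the `D_ϖ`-conjugate of the nilpotent, conjugation `U(J♯) → U(J₀)` -/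

section Algebra

variable (σ : F →+* F)

omit [ValuativeRel F] in
/-- `(c • (1 + tN))ᴴ J♯ (c • (1 + tN)) = J♯` when `σ c · c = 1` and `t δ` is σ-FIXED (`σ t = t`, `σ δ = δ`): the even-depth window elements are `J♯`-unitary.
[cite: Jacobowitz1962, §4] -/
theorem conjTranspose_normalForm_mul_skew_mul {c t δ : F} (hc : σ c * c = 1) (ht : σ t = t) (hδ : σ δ = δ) :
    ((c • ((1 : Matrix (Fin 2) (Fin 2) F) + t • !![0, δ; 0, 0])).map σ)ᵀ * !![0, -1; 1, 0] * (c • ((1 : Matrix (Fin 2) (Fin 2) F) + t • !![0, δ; 0, 0])) =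
      !![0, -1; 1, 0] := by
  have h : c • ((1 : Matrix (Fin 2) (Fin 2) F) + t • !![0, δ; 0, 0]) = !![c, c * (t * δ); 0, c] := by
    ext i j; fin_cases i <;> fin_cases j <;> simp
  rw [h]
  ext i j
  fin_cases i <;> fin_cases j <;> simp [Matrix.mul_apply, Fin.sum_univ_two, ht, hδ, hc]
  ring

omit [ValuativeRel F] in
/-- `D·N(δ)·D⁻¹ = N(δ ϖ⁻¹)` for `D = diag(1, ϖ)` (as matrices; `D⁻¹` written `diag(1, ϖ⁻¹)`). [cite: Jacobowitz1962, §4] -/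
theorem diag_mul_nil_mul_diag (ϖ δ : F) :
    (!![1, 0; 0, ϖ] : Matrix (Fin 2) (Fin 2) F) * !![0, δ; 0, 0] * !![1, 0; 0, ϖ⁻¹] = !![0, δ * ϖ⁻¹; 0, 0] := by
  ext i j; fin_cases i <;> fin_cases j <;> simp [Matrix.mul_apply, Fin.sum_univ_two]

omit [ValuativeRel F] in
/-- **Conjugation by a form-intertwiner**: if `Dᴴ J D = s • J′` then `D·U(J′)·D⁻¹ ⊆ U(J)` — for `y` with `yᴴJ′y = J′`, `(DyD⁻¹)ᴴ J (DyD⁻¹) = J`. [cite: Jacobowitz1962, §4] -/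
theorem conjTranspose_conj_mul_mul_conj_eq (J J' : Matrix (Fin 2) (Fin 2) F) (D : GL (Fin 2) F) {s : F}
    (hDJ : ((D : Matrix (Fin 2) (Fin 2) F).map σ)ᵀ * J * (D : Matrix (Fin 2) (Fin 2) F) = s • J')
    {y : Matrix (Fin 2) (Fin 2) F} (hy : (y.map σ)ᵀ * J' * y = J') :
    (((D : Matrix (Fin 2) (Fin 2) F) * y * ((D⁻¹ : GL (Fin 2) F) : Matrix (Fin 2) (Fin 2) F)).map σ)ᵀ * J *
        ((D : Matrix (Fin 2) (Fin 2) F) * y * ((D⁻¹ : GL (Fin 2) F) : Matrix (Fin 2) (Fin 2) F)) = J := by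
  set Dm : Matrix (Fin 2) (Fin 2) F := (D : Matrix (Fin 2) (Fin 2) F) with hDm
  set Di : Matrix (Fin 2) (Fin 2) F := ((D⁻¹ : GL (Fin 2) F) : Matrix (Fin 2) (Fin 2) F) with hDi
  have hDDi : Dm * Di = 1 := by rw [hDm, hDi, ← Units.val_mul, mul_inv_cancel, Units.val_one]
  have hHH : (Di.map σ)ᵀ * (Dm.map σ)ᵀ = 1 := by
    rw [← Matrix.transpose_mul, ← Matrix.map_mul, hDDi, Matrix.map_one σ (map_zero σ) (map_one σ), Matrix.transpose_one]
  -- `J = s • Diᴴ J′ Di`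
  have hJ : J = s • ((Di.map σ)ᵀ * J' * Di) := by
    calc J = ((Di.map σ)ᵀ * (Dm.map σ)ᵀ) * J * (Dm * Di) := by rw [hHH, hDDi, Matrix.one_mul, Matrix.mul_one]
      _ = (Di.map σ)ᵀ * ((Dm.map σ)ᵀ * J * Dm) * Di := by simp only [Matrix.mul_assoc]
      _ = s • ((Di.map σ)ᵀ * J' * Di) := by rw [hDJ, Matrix.mul_smul, Matrix.smul_mul, Matrix.mul_assoc]
  calc ((Dm * y * Di).map σ)ᵀ * J * (Dm * y * Di) = (Di.map σ)ᵀ * (y.map σ)ᵀ * ((Dm.map σ)ᵀ * J * Dm) * y * Di := by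
        simp only [Matrix.map_mul, Matrix.transpose_mul, Matrix.mul_assoc]
    _ = (Di.map σ)ᵀ * (y.map σ)ᵀ * (s • J') * y * Di := by rw [hDJ]
    _ = s • ((Di.map σ)ᵀ * ((y.map σ)ᵀ * J' * y) * Di) := by simp only [Matrix.mul_smul, Matrix.smul_mul, Matrix.mul_assoc]
    _ = J := by rw [hy, ← hJ]

end Algebra

/-! ## §2 The even-depth window elements in `U(J♯) ∩ GL₂(𝒪)` -/

section Elements

variable (σ : F →+* F)

/-- **THE SIGNED NORMAL-FORM ELEMENTS AT A VERTEX (tamely ramified).**  For `σ c · c = 1` with `|c| = 1`, `σ ϖ = −ϖ` with `ϖ ∈ 𝒪`, `σ η = η` with `η ∈ 𝒪`, and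
`J = J♯ = [[0,−1],[1,0]]`: there are `xm ∈ U(J)` and `x : ℕ → ℕ → U(J)`, all in `GL₂(𝒪)`, with `↑xm = c • 1`, `↑xm⁻¹ = c⁻¹ • 1`, and FOR EVEN `i`:
`↑(x i e) = c • (1 + ϖ^i • [[0, η^e],[0,0]])`, `↑(x i e)⁻¹ = c⁻¹ • (1 − ϖ^i • [[0, η^e],[0,0]])` (unitarity: `σ(ϖ^i η^e) = ϖ^i η^e` for even `i`).
[cite: LabesseLanglands1979, §2 Lemma 2.1 pp. 8–9] [cite: Rogawski1990, §4.9 Lemma 4.9.3 p. 56] -/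
theorem exists_unitary_signedNormalForm_elements_modular (J : Matrix (Fin 2) (Fin 2) F) (hJ : J = !![0, -1; 1, 0]) {c ϖ η : F} (hc : σ c * c = 1)
    (hc1 : valuation F c = 1) (hσϖ : σ ϖ = -ϖ) (hϖO : ϖ ∈ 𝒪[F]) (hση : σ η = η) (hηO : η ∈ 𝒪[F]) :
    ∃ (xm : ↥(unitaryGroupOfForm σ J)) (x : ℕ → ℕ → ↥(unitaryGroupOfForm σ J)),
      (xm : GL (Fin 2) F) ∈ glInt 2 F ∧ (∀ i e, (x i e : GL (Fin 2) F) ∈ glInt 2 F) ∧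
      ((xm : GL (Fin 2) F) : Matrix (Fin 2) (Fin 2) F) = c • (1 : Matrix (Fin 2) (Fin 2) F) ∧
      (((xm : GL (Fin 2) F)⁻¹ : GL (Fin 2) F) : Matrix (Fin 2) (Fin 2) F) = c⁻¹ • (1 : Matrix (Fin 2) (Fin 2) F) ∧
      (∀ i e, Even i → ((x i e : GL (Fin 2) F) : Matrix (Fin 2) (Fin 2) F) = c • ((1 : Matrix (Fin 2) (Fin 2) F) + ϖ ^ i • !![0, η ^ e; 0, 0])) ∧
      (∀ i e, Even i → (((x i e : GL (Fin 2) F)⁻¹ : GL (Fin 2) F) : Matrix (Fin 2) (Fin 2) F) =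
        c⁻¹ • ((1 : Matrix (Fin 2) (Fin 2) F) - ϖ ^ i • !![0, η ^ e; 0, 0])) := by
  subst hJ
  have hc0 : c ≠ 0 := fun h => by rw [h, mul_zero] at hc; exact zero_ne_one hc
  have hcO : c ∈ 𝒪[F] := (Valuation.mem_integer_iff _ _).2 hc1.le
  have hcO' : c⁻¹ ∈ 𝒪[F] := (Valuation.mem_integer_iff _ _).2 (by rw [map_inv₀, hc1, inv_one])
  -- the `GL₂` elements with matrix `c(1 + t N_δ)`, inverse `c⁻¹(1 − t N_δ)`
  let g : F → F → GL (Fin 2) F := fun t δ =>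
    ⟨c • ((1 : Matrix (Fin 2) (Fin 2) F) + t • !![0, δ; 0, 0]), c⁻¹ • ((1 : Matrix (Fin 2) (Fin 2) F) - t • !![0, δ; 0, 0]),
      by rw [Matrix.smul_mul, Matrix.mul_smul, smul_smul, mul_inv_cancel₀ hc0, one_smul, one_add_smul_nil_mul_one_sub_smul_nil],
      by rw [Matrix.smul_mul, Matrix.mul_smul, smul_smul, inv_mul_cancel₀ hc0, one_smul, one_sub_smul_nil_mul_one_add_smul_nil]⟩
  have hgU : ∀ t δ : F, σ t = t → σ δ = δ → g t δ ∈ unitaryGroupOfForm σ !![0, -1; 1, 0] := fun t δ ht hδ =>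
    mem_unitaryGroupOfForm_iff.2 (conjTranspose_normalForm_mul_skew_mul σ hc ht hδ)
  have hgI : ∀ t δ : F, t ∈ 𝒪[F] → δ ∈ 𝒪[F] → g t δ ∈ glInt 2 F := by
    intro t δ htO hδO
    refine (mem_glInt_iff (g t δ)).2 ⟨fun r s => ?_, fun r s => ?_⟩
    · show (c • ((1 : Matrix (Fin 2) (Fin 2) F) + t • !![0, δ; 0, 0])) r s ∈ 𝒪[F]
      fin_cases r <;> fin_cases s <;>
        simp only [Matrix.smul_apply, Matrix.add_apply, Matrix.one_apply, Matrix.of_apply, Matrix.cons_val', Matrix.cons_val_zero, Matrix.cons_val_one,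
          Matrix.cons_val_fin_one, Fin.zero_eta, Fin.mk_one, smul_eq_mul, Fin.isValue, if_true, one_ne_zero, zero_ne_one, if_false, mul_zero, add_zero, zero_add,
          mul_one] <;>
        first | exact hcO | exact zero_mem _ | exact mul_mem hcO (mul_mem htO hδO)
    · show (c⁻¹ • ((1 : Matrix (Fin 2) (Fin 2) F) - t • !![0, δ; 0, 0])) r s ∈ 𝒪[F]
      fin_cases r <;> fin_cases s <;>
        simp only [Matrix.smul_apply, Matrix.sub_apply, Matrix.one_apply, Matrix.of_apply, Matrix.cons_val', Matrix.cons_val_zero, Matrix.cons_val_one,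
          Matrix.cons_val_fin_one, Fin.zero_eta, Fin.mk_one, smul_eq_mul, Fin.isValue, if_true, one_ne_zero, zero_ne_one, if_false, mul_zero, sub_zero, zero_sub,
          mul_one, mul_neg] <;>
        first | exact hcO' | exact zero_mem _ | exact neg_mem (mul_mem hcO' (mul_mem htO hδO))
  -- the scalar element = `g 0 0`
  have hg00 : ((g 0 0 : GL (Fin 2) F) : Matrix (Fin 2) (Fin 2) F) = c • (1 : Matrix (Fin 2) (Fin 2) F) := by
    show c • ((1 : Matrix (Fin 2) (Fin 2) F) + (0 : F) • !![0, (0 : F); 0, 0]) = _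
    rw [zero_smul, add_zero]
  have hg00' : (((g 0 0 : GL (Fin 2) F)⁻¹ : GL (Fin 2) F) : Matrix (Fin 2) (Fin 2) F) = c⁻¹ • (1 : Matrix (Fin 2) (Fin 2) F) := by
    show c⁻¹ • ((1 : Matrix (Fin 2) (Fin 2) F) - (0 : F) • !![0, (0 : F); 0, 0]) = _
    rw [zero_smul, sub_zero]
  have h0U := hgU 0 0 (map_zero σ) (map_zero σ)
  have h0I := hgI 0 0 (zero_mem _) (zero_mem _)
  -- the window elements for even `i` (else the scalar)
  have key : ∀ i e : ℕ, ∃ y : ↥(unitaryGroupOfForm σ !![0, -1; 1, 0]), (y : GL (Fin 2) F) ∈ glInt 2 F ∧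
      (Even i → ((y : GL (Fin 2) F) : Matrix (Fin 2) (Fin 2) F) = c • ((1 : Matrix (Fin 2) (Fin 2) F) + ϖ ^ i • !![0, η ^ e; 0, 0]) ∧
        (((y : GL (Fin 2) F)⁻¹ : GL (Fin 2) F) : Matrix (Fin 2) (Fin 2) F) = c⁻¹ • ((1 : Matrix (Fin 2) (Fin 2) F) - ϖ ^ i • !![0, η ^ e; 0, 0])) := by
    intro i e
    by_cases hi : Even i
    · have ht : σ (ϖ ^ i) = ϖ ^ i := by rw [map_pow, hσϖ, hi.neg_pow]
      have hδ : σ (η ^ e) = η ^ e := by rw [map_pow, hση]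
      exact ⟨⟨g (ϖ ^ i) (η ^ e), hgU _ _ ht hδ⟩, hgI _ _ (pow_mem hϖO i) (pow_mem hηO e), fun _ => ⟨rfl, rfl⟩⟩
    · exact ⟨⟨g 0 0, h0U⟩, h0I, fun h => absurd h hi⟩
  choose x hxI hx using key
  exact ⟨⟨g 0 0, h0U⟩, x, h0I, hxI, hg00, hg00', fun i e hi => ((hx i e) hi).1, fun i e hi => ((hx i e) hi).2⟩

end Elements

/-! ## §3 The `D_ϖ`-conjugated family in `U(J₀) ∩ K♯` -/

section Conjugated

variable (σ : F →+* F)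

omit [ValuativeRel F] in
/-- `D_ϖᴴ J₀ D_ϖ = (−ϖ) • J♯` for `D_ϖ = diag(1, ϖ)`, `σϖ = −ϖ`. [cite: Jacobowitz1962, §4] -/
theorem conjTranspose_diag_mul_swap_mul_diag {ϖ : F} (hσϖ : σ ϖ = -ϖ) :
    (((!![1, 0; 0, ϖ] : Matrix (Fin 2) (Fin 2) F)).map σ)ᵀ * !![0, 1; 1, 0] * !![1, 0; 0, ϖ] = (-ϖ) • (!![0, -1; 1, 0] : Matrix (Fin 2) (Fin 2) F) := by
  ext i j
  fin_cases i <;> fin_cases j <;> simp [Matrix.mul_apply, Fin.sum_univ_two, hσϖ]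

/-- **THE CONJUGATED SIGNED NORMAL-FORM ELEMENTS (vertex piece inside `U(J₀)`).**  `J₀ = [[0,1],[1,0]]`, `D ∈ GL₂(F)` with matrix `diag(1, ϖ)`, `σ c · c = 1`,
`|c| = 1`, `σ ϖ = −ϖ`, `ϖ ∈ 𝒪`, `σ η = η`, `η ∈ 𝒪`: there are `xm ∈ U(J₀)` and `x : ℕ → ℕ → U(J₀)`, all in `K♯ := (GL₂(𝒪)).map (conj D)`, with `↑xm = c • 1`,
`↑xm⁻¹ = c⁻¹ • 1`, and FOR EVEN `i`: `↑(x i e) = c • (1 + ϖ^i • (D·[[0, η^e],[0,0]]·D⁻¹))`, `↑(x i e)⁻¹ = c⁻¹ • (1 − ϖ^i • (D·[[0, η^e],[0,0]]·D⁻¹))` — the CONJUGATED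
spelling is kept on purpose (`i = 0` occurs at the vertex piece; `D N(δ) D⁻¹ = N(δϖ⁻¹)` by `diag_mul_nil_mul_diag`). [cite: LabesseLanglands1979, §2 Lemma 2.1 pp. 8–9]
[cite: Rogawski1990, §4.9 Lemma 4.9.3 p. 56] -/
theorem exists_conj_signedNormalForm_elements_modular (J₀ : Matrix (Fin 2) (Fin 2) F) (hJ₀ : J₀ = !![0, 1; 1, 0]) {c ϖ η : F} (D : GL (Fin 2) F)
    (hD : (D : Matrix (Fin 2) (Fin 2) F) = !![1, 0; 0, ϖ]) (hc : σ c * c = 1) (hc1 : valuation F c = 1)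
    (hσϖ : σ ϖ = -ϖ) (hϖO : ϖ ∈ 𝒪[F]) (hση : σ η = η) (hηO : η ∈ 𝒪[F]) :
    ∃ (xm : ↥(unitaryGroupOfForm σ J₀)) (x : ℕ → ℕ → ↥(unitaryGroupOfForm σ J₀)),
      (xm : GL (Fin 2) F) ∈ (glInt 2 F).map (MulAut.conj D).toMonoidHom ∧ (∀ i e, (x i e : GL (Fin 2) F) ∈ (glInt 2 F).map (MulAut.conj D).toMonoidHom) ∧
      ((xm : GL (Fin 2) F) : Matrix (Fin 2) (Fin 2) F) = c • (1 : Matrix (Fin 2) (Fin 2) F) ∧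
      (((xm : GL (Fin 2) F)⁻¹ : GL (Fin 2) F) : Matrix (Fin 2) (Fin 2) F) = c⁻¹ • (1 : Matrix (Fin 2) (Fin 2) F) ∧
      (∀ i e, Even i → ((x i e : GL (Fin 2) F) : Matrix (Fin 2) (Fin 2) F) =
        c • ((1 : Matrix (Fin 2) (Fin 2) F) + ϖ ^ i • ((D : Matrix (Fin 2) (Fin 2) F) * !![0, η ^ e; 0, 0] * ((D⁻¹ : GL (Fin 2) F) : Matrix (Fin 2) (Fin 2) F)))) ∧
      (∀ i e, Even i → (((x i e : GL (Fin 2) F)⁻¹ : GL (Fin 2) F) : Matrix (Fin 2) (Fin 2) F) =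
        c⁻¹ • ((1 : Matrix (Fin 2) (Fin 2) F) - ϖ ^ i • ((D : Matrix (Fin 2) (Fin 2) F) * !![0, η ^ e; 0, 0] * ((D⁻¹ : GL (Fin 2) F) : Matrix (Fin 2) (Fin 2) F)))) := by
  subst hJ₀
  obtain ⟨xm, x, hxmI, hxI, hxm, hxm', hx, hx'⟩ :=
    exists_unitary_signedNormalForm_elements_modular σ !![0, -1; 1, 0] rfl hc hc1 hσϖ hϖO hση hηO
  have hDJ : ((D : Matrix (Fin 2) (Fin 2) F).map σ)ᵀ * !![0, 1; 1, 0] * (D : Matrix (Fin 2) (Fin 2) F) = (-ϖ) • (!![0, -1; 1, 0] : Matrix (Fin 2) (Fin 2) F) := by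
    rw [hD]; exact conjTranspose_diag_mul_swap_mul_diag σ hσϖ
  have hDDi : (D : Matrix (Fin 2) (Fin 2) F) * ((D⁻¹ : GL (Fin 2) F) : Matrix (Fin 2) (Fin 2) F) = 1 := by
    rw [← Units.val_mul, mul_inv_cancel, Units.val_one]
  -- conjugation `y ↦ D y D⁻¹` lands in `U(J₀)`
  have hconjU : ∀ y : ↥(unitaryGroupOfForm σ !![0, -1; 1, 0]), D * (y : GL (Fin 2) F) * D⁻¹ ∈ unitaryGroupOfForm σ !![0, 1; 1, 0] := fun y => by
    rw [mem_unitaryGroupOfForm_iff, Units.val_mul, Units.val_mul]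
    exact conjTranspose_conj_mul_mul_conj_eq σ !![0, 1; 1, 0] !![0, -1; 1, 0] D hDJ (mem_unitaryGroupOfForm_iff.1 y.2)
  have hconjK : ∀ y : ↥(unitaryGroupOfForm σ !![0, -1; 1, 0]), (y : GL (Fin 2) F) ∈ glInt 2 F →
      D * (y : GL (Fin 2) F) * D⁻¹ ∈ (glInt 2 F).map (MulAut.conj D).toMonoidHom := fun y hy =>
    Subgroup.mem_map.2 ⟨(y : GL (Fin 2) F), hy, by simp [MulAut.conj_apply]⟩
  -- matrices of the conjugates
  have hmat : ∀ (t : F) (N : Matrix (Fin 2) (Fin 2) F) (y : GL (Fin 2) F), (y : Matrix (Fin 2) (Fin 2) F) = c • (1 + t • N) →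
      ((D * y * D⁻¹ : GL (Fin 2) F) : Matrix (Fin 2) (Fin 2) F) =
        c • ((1 : Matrix (Fin 2) (Fin 2) F) + t • ((D : Matrix (Fin 2) (Fin 2) F) * N * ((D⁻¹ : GL (Fin 2) F) : Matrix (Fin 2) (Fin 2) F))) := by
    intro t N y hy
    rw [Units.val_mul, Units.val_mul, hy, Matrix.mul_smul, Matrix.smul_mul, Matrix.mul_add, Matrix.mul_one, Matrix.add_mul, hDDi, Matrix.mul_smul,
      Matrix.smul_mul, Matrix.mul_assoc]
  have hmat' : ∀ (t : F) (N : Matrix (Fin 2) (Fin 2) F) (y : GL (Fin 2) F), ((y⁻¹ : GL (Fin 2) F) : Matrix (Fin 2) (Fin 2) F) = c⁻¹ • (1 - t • N) →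
      (((D * y * D⁻¹)⁻¹ : GL (Fin 2) F) : Matrix (Fin 2) (Fin 2) F) =
        c⁻¹ • ((1 : Matrix (Fin 2) (Fin 2) F) - t • ((D : Matrix (Fin 2) (Fin 2) F) * N * ((D⁻¹ : GL (Fin 2) F) : Matrix (Fin 2) (Fin 2) F))) := by
    intro t N y hy
    rw [show (D * y * D⁻¹)⁻¹ = D * y⁻¹ * D⁻¹ by group, Units.val_mul, Units.val_mul, hy, Matrix.mul_smul,
      Matrix.smul_mul, Matrix.mul_sub, Matrix.mul_one, Matrix.sub_mul, hDDi, Matrix.mul_smul, Matrix.smul_mul, Matrix.mul_assoc]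
  refine ⟨⟨D * (xm : GL (Fin 2) F) * D⁻¹, hconjU xm⟩, fun i e => ⟨D * (x i e : GL (Fin 2) F) * D⁻¹, hconjU (x i e)⟩, hconjK xm hxmI,
    fun i e => hconjK (x i e) (hxI i e), ?_, ?_, fun i e hi => ?_, fun i e hi => ?_⟩
  · have h := hmat 0 0 (xm : GL (Fin 2) F) (by rw [hxm, zero_smul, add_zero])
    rw [zero_smul, add_zero] at h; exact h
  · have h := hmat' 0 0 (xm : GL (Fin 2) F) (by rw [hxm', zero_smul, sub_zero])
    rw [zero_smul, sub_zero] at h; exact h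
  · exact hmat (ϖ ^ i) !![0, η ^ e; 0, 0] (x i e : GL (Fin 2) F) (hx i e hi)
  · exact hmat' (ϖ ^ i) !![0, η ^ e; 0, 0] (x i e : GL (Fin 2) F) (hx' i e hi)

end Conjugated

end Literature.NumberTheory.Automorphic

end
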